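import Mathlib
import HarnessLib
import Summits.AtomisticToContinuum.HydrodynamicLimit.Theses.JParityClosure

/-!
# Sketch — first lemmas of three crux ideas for `JParityClosure.LocalSecondLaw`
(stmt-AtomisticToContinuum-13081; crux-ideate round 1, ideator 3).

Nothing here is filed as an item; these Props/lemmas only certify that the first checkable
statement of each line elaborates over existing declarations.
-/

noncomputable section

open MeasureTheory Filter Set
open scoped BigOperators ENNReal

namespace Summit.AtomisticToContinuum.HydrodynamicLimit.Cruxes.LocalSecondLaw.Sketch

open Literature.MathematicalPhysics.KineticTheory (T3 V3)
open Literature.Analysis.FunctionSpaces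

/-! ## Card 1 (exact-entropy-ledger): the configurational work identity

Pure torus calculus: for smooth positive `ρ`, smooth `m`, exact continuity `∂ₛρ + div m = 0`,
a `C²` excess free energy `G` and a smooth test function `φ ≥ 0` vanishing after `τ' < τ`,
the configurational part of the crux functional equals the excess-pressure work against the
resolved compression: `∫∫ ρG(ρ)(∂ₛφ + (m/ρ)·∇φ) + ∫ ρ₀G(ρ₀)φ₀ = ∫∫ φ ρ² G'(ρ) div(m/ρ)`.
In the line it is applied pathwise to the `r`-mollified empirical fields of the crux (same cone
kernel for `ρ_r` and `m_r`, so continuity is an identity), with `G = hsExcessFreeEnergy (· σ³)`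
smooth in the band by `HsEosLowDensity`. -/
def ConfigurationalWorkIdentity : Prop :=
  ∀ (τ : ℝ), 0 < τ →
  ∀ (ρ φ : ℝ → T3 → ℝ) (m : ℝ → T3 → V3) (G : ℝ → ℝ),
    Torus.IsSmoothSpaceTimeOn Set.univ ρ → Torus.IsSmoothSpaceTimeOn Set.univ φ →
    Torus.IsSmoothSpaceTimeOn Set.univ m → ContDiff ℝ 2 G →
    (∀ s x, 0 < ρ s x) → (∀ s x, 0 ≤ φ s x) →
    (∃ τ' : ℝ, τ' < τ ∧ ∀ s, τ' ≤ s → ∀ x, φ s x = 0) →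
    (∀ s x, Torus.timeDeriv ρ s x + Torus.divergence (m s) x = 0) →
    (∫ s in Set.Icc (0 : ℝ) τ, ∫ x : T3,
        ρ s x * G (ρ s x) *
          (Torus.timeDeriv φ s x + ∑ k : Fin 3, (m s x) k / ρ s x * Torus.partialDeriv k (φ s) x))
      + ∫ x : T3, ρ 0 x * G (ρ 0 x) * φ 0 x
    = ∫ s in Set.Icc (0 : ℝ) τ, ∫ x : T3,
        φ s x * (ρ s x) ^ 2 * deriv G (ρ s x) *
          Torus.divergence (fun y => (ρ s y)⁻¹ • m s y) x

/-! ## Card 2 (termwise-even-channel): the even collision channel is signed term by term -/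

/-- The elementary inequality behind the even channel: `F (1 - e^{-F}) ≥ 0` for every real `F`
(both factors have the sign of `F`). No molecular chaos, no limit. -/
theorem evenChannel_nonneg (F : ℝ) : 0 ≤ F * (1 - Real.exp (-F)) := by
  rcases le_or_gt 0 F with hF | hF
  · apply mul_nonneg hF
    have : Real.exp (-F) ≤ 1 := by
      rw [Real.exp_le_one_iff]
      linarith
    linarith
  · have h1 : 1 < Real.exp (-F) := by
      rw [Real.one_lt_exp_iff]
      linarith
    have : F * (1 - Real.exp (-F)) = (-F) * (Real.exp (-F) - 1) := by ring
    rw [this]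
    apply mul_nonneg <;> linarith

/-- Pathwise non-negativity of the EVEN-CHANNEL collision statistic of the crux route's own
objects (the reweighting `1 - e^{-F}` in place of crux 2's `1 + e^{-F}`): for every flow, every
phase point, every non-negative weight `χ` and cutoff `g`, every `r, ϑ`, the statistic
`(ε/(N+1)) Σ_{collisions ≤ τ} Σ_{contact pairs} χ g F (1 - e^{-F})` is `≥ 0`, with `F` the
surprisal jump read off the `(r,ϑ)`-mollified empirical one-particle law exactly as in
`OddContactSymmetry`. (In the line the same statistic at a MESOSCOPIC `r = r_N` with
`N^{1/3} r_N⁴ → 0` is the signed production that pays for shocks.) -/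
def EvenChannelPathwiseNonneg : Prop :=
  ∀ (σ : ℝ), 0 < σ → ∀ (N : ℕ)
    (Φ : Literature.Analysis.FluidPDE.HardSphereFlow (Literature.Analysis.FluidPDE.Torus.geometry (Fin 3))
      (Literature.MathematicalPhysics.KineticTheory.hsDiameter σ N) (N + 1)),
    ∀ τ : ℝ, 0 < τ → ∀ χ : ℝ × UnitAddTorus (Fin 3) → ℝ, (∀ p, 0 ≤ χ p) →
    ∀ g : ℝ → ℝ, (∀ a, 0 ≤ g a) → ∀ r ϑ : ℝ, 0 < r → 0 < ϑ →
    ∀ z : Literature.Analysis.FluidPDE.Config (N + 1) (Fin 3) T3,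
    let ε := Literature.MathematicalPhysics.KineticTheory.hsDiameter σ N
    let G := Literature.Analysis.FluidPDE.Torus.geometry (Fin 3)
    let γ := fun z (s : ℝ) => Φ.flow s z
    let bx : UnitAddTorus (Fin 3) → UnitAddTorus (Fin 3) → ℝ :=
      fun x y => 3 / (Real.pi * r ^ 3) * max (1 - Literature.Analysis.FluidPDE.Torus.euclidDist x y / r) 0
    let ρm := fun z s (x₀ : UnitAddTorus (Fin 3)) =>
      ∫ q, bx q.1 x₀ ∂(Literature.Analysis.FluidPDE.empiricalMeasure (γ z s))
    let hm := fun z s (x₀ : UnitAddTorus (Fin 3)) (v : EuclideanSpace ℝ (Fin 3)) =>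
      ∫ q, bx q.1 x₀ * Literature.Analysis.FluidPDE.localMaxwellian 1 (ϑ ^ 2) v q.2
        ∂(Literature.Analysis.FluidPDE.empiricalMeasure (γ z s))
    let pv := fun z s (i j : Fin (N + 1)) =>
      Literature.Analysis.FluidPDE.reflectVel (G.sepVec (γ z s i).1 (γ z s j).1) ((γ z s i).2, (γ z s j).2)
    let F := fun z s (i j : Fin (N + 1)) =>
      Real.log (hm z s (γ z s i).1 (pv z s i j).1) + Real.log (hm z s (γ z s i).1 (pv z s i j).2)
        - Real.log (hm z s (γ z s i).1 (γ z s i).2) - Real.log (hm z s (γ z s i).1 (γ z s j).2)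
    let Kc := fun (Fn : Literature.Analysis.FluidPDE.Config (N + 1) (Fin 3) T3 → ℝ → Fin (N + 1) → Fin (N + 1) → ℝ) z =>
      ε / (N + 1 : ℝ) * ∑ᶠ (s : ℝ) (_ : s ∈ Literature.Analysis.FluidPDE.collisionTimes G ε (γ z) ∩ Set.Icc 0 τ),
        ∑ i : Fin (N + 1), ∑ j : Fin (N + 1),
          (if i ≠ j ∧ ‖G.sepVec (γ z s i).1 (γ z s j).1‖ = ε then Fn z s i j else 0)
    let D := fun z => Kc (fun z s i j => χ (s, (γ z s i).1) * g (σ ^ 3 * ρm z s (γ z s i).1) *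
      (F z s i j * (1 - Real.exp (-F z s i j)))) z
    0 ≤ D z

/-! ## Card 3 (label-group Clausius audit): the information-theoretic kernel

A kick of the `X`-coordinate by a family of `μ`-preserving maps `T_y` driven by a correlated
parameter `y` cannot raise the neg-entropy (relative entropy to the reference `μ`) of the
`X`-marginal by more than the available budget: `D((kick P)_X ‖ μ) + D(P_Y ‖ ν) ≤ D(P ‖ μ ⊗ ν)`,
i.e. `D((kick P)_X ‖ μ) ≤ D(P_X ‖ μ) + I_P(X;Y)`. In the line `X` = phase point of a Lagrangian
label group, `y` = (partner velocity, impact geometry) of a cross collision, `T_y` = the hard-sphere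
reflection of the struck particle's velocity, and the budget `I` is what CrossContactFreshness
must make `o(1)` per cross collision beyond its local-equilibrium value `0`. -/
def KickNegentropyBound : Prop :=
  ∀ (X Y : Type) [MeasurableSpace X] [MeasurableSpace Y]
    (μ : Measure X) (ν : Measure Y) [SigmaFinite μ] [SigmaFinite ν]
    (P : Measure (X × Y)) [IsProbabilityMeasure P]
    (T : Y → X → X), Measurable (fun p : X × Y => (T p.2 p.1, p.2)) →
    (∀ y, MeasurePreserving (T y) μ μ) →
    InformationTheory.klDiv ((P.map fun p : X × Y => (T p.2 p.1, p.2)).fst) μ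
        + InformationTheory.klDiv P.snd ν
      ≤ InformationTheory.klDiv P (μ.prod ν)

/-- The three lines all conclude the crux BY NAME; recorded here only as the shape the
crux-plan skeletons will have to certify (`… → LocalSecondLaw`). -/
def TargetShape : Prop :=
  ConfigurationalWorkIdentity → EvenChannelPathwiseNonneg → KickNegentropyBound →
    Summit.AtomisticToContinuum.HydrodynamicLimit.Theses.JParityClosure.LocalSecondLaw

end Summit.AtomisticToContinuum.HydrodynamicLimit.Cruxes.LocalSecondLaw.Sketch

end
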